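import Summits.NavierStokesRegularity.NavierStokesRegularity.Theorems.ExtremiserTransienceBangBangCoreDefs
import Summits.NavierStokesRegularity.NavierStokesRegularity.Theorems.ExtremiserTransienceZoneTransversalityDefs
import Summits.NavierStokesRegularity.NavierStokesRegularity.Theorems.ExtremiserTransiencePlateauSliceRigidity
import HarnessLib

/-!
# Route `ExtremiserTransience`, crux `NearExtremalTransiencePerFlow` (stmt-NavierStokesRegularity-26567),
# LINE g8-α «sparse bang-bang»: THE TEXTS OF RECORD of §0–§1 (vocabulary and the three statements S-B / S-E / S-T)

Texts of record, VERBATIM §0–§1 of the published line `Cruxes/NearExtremalTransiencePerFlow/Lines/sparse_bangbang.lean`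
(planner ns-idea-5 g8, commit 8d180b13bde1; critic verdict PASS idea-crit-4 2026-08-28T21:06:12Z; a crux WORKFILE under KEY-NS #155,
not the registered skeleton of record), so that the line's stubs can be stated BY NAME in `Theorems/` files (a `Cruxes/` file is not
importable from `Theorems/`):
* `topSet v M δ`, `cellNumber v M`, `IsSparse N₀ v M` — near-top set, cell number `W·λ/M²`, sparseness `W·λ ≤ N₀·M²`
  (over the tree's `KStar.HalfSpace.{Zen, Wpa, Jst, kStar}` and `KStar.BangBang.{lam, IsAdm, IsReg}`);
* `WeakPlateauObject` — the weak one-slice plateau object of item 27822 (verbatim the existential negated by `PlateauSliceRigidity`);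
* `SparseNearPlateauStability` (S-B, provable; prover hand ns-net-p2), `SparseEfficientTimes` (S-E, the open heart),
  `SparseSliceTransfer` (S-T, provable-grade transfer; prover hand ns-net-p1).
The violator frame `IsViolator` (with `PFC`) is the landed text of record `…Theorems.NearExtremalTransiencePerFlow.ZoneTransversality.IsViolator`
(file `ExtremiserTransienceZoneTransversalityDefs`), exactly as the line imports it.  All bodies are the line's, so the line's
`stub_sparseNearPlateauStability` / `stub_sparseSliceTransfer` close by `exact` from theorems stated with these names.
Landed by prover seat `ns-net-p1` (g2). HONEST FRAMING: definitions only (statements about hypothetical Type-I singular flows and one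
scale-invariant functional); nothing about Navier–Stokes regularity or blow-up is proved; no summit is proved by a line.
-/

noncomputable section

open scoped Topology InnerProductSpace RealInnerProductSpace ENNReal ContDiff
open MeasureTheory Filter Set Metric
open Literature.Analysis.FluidPDE
open Summit.NavierStokesRegularity.NavierStokesRegularity.Theorems.DepletionLadder.KStar
open Summit.NavierStokesRegularity.NavierStokesRegularity.Theorems.DepletionLadder.KStar.HalfSpace
open Summit.NavierStokesRegularity.NavierStokesRegularity.Theorems.DepletionLadder.KStar.BangBang
open Summit.NavierStokesRegularity.NavierStokesRegularity.Theorems.NearExtremalTransiencePerFlow.ZoneTransversality (PFC IsViolator)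

namespace Summit.NavierStokesRegularity.NavierStokesRegularity.Theorems.NearExtremalTransiencePerFlow.SparseBangBang

-- the problem directory repeats the summit name (`NavierStokesRegularity/NavierStokesRegularity`)
set_option linter.dupNamespace false

/-- The NEAR-TOP SET of `v` at height `M` and threshold `δ`: `{x | (1−δ)·M ≤ ‖v x‖}`. -/
def topSet (v : E3 → E3) (M δ : ℝ) : Set E3 := {x | (1 - δ) * M ≤ ‖v x‖}

/-- The dimensionless CELL NUMBER `N(v,M) = W·λ/M²` (`= Z/(M²λ)`, `λ = √(Z/W)`): the number of `λ`-cells of full-size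
vorticity `M/λ` that the enstrophy budget can pay for.  Copy-additive: `N` copies of a field have cell number `N`-fold. -/
def cellNumber (v : E3 → E3) (M : ℝ) : ℝ := Wpa v * lam v / M ^ 2

/-- `v` is `N₀`-SPARSE at height `M`: cell number `≤ N₀`, i.e. `W·λ ≤ N₀·M²`. -/
def IsSparse (N₀ : ℝ) (v : E3 → E3) (M : ℝ) : Prop := Wpa v * lam v ≤ N₀ * M ^ 2

/-- The WEAK ONE-SLICE PLATEAU OBJECT of item 27822 (verbatim the existential negated by `PlateauSliceRigidity`):
a field `W` on `(−∞,0) × ℝ³`, jointly continuous, Oseen-mild between all `s < t < 0`, Type-I `√(−t)‖W(t)‖_∞ ≤ K`,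
with a slice `W t₀` attaining its maximum speed `m > 0` on a set of positive volume. -/
def WeakPlateauObject : Prop :=
  ∃ (W : ℝ → EuclideanSpace ℝ (Fin 3) → EuclideanSpace ℝ (Fin 3)) (K t₀ m : ℝ),
    ContinuousOn (Function.uncurry W) (Set.Iio (0 : ℝ) ×ˢ Set.univ) ∧
    (∀ s t : ℝ, s < t → t < 0 → ∀ x, W t x = Literature.Analysis.FluidPDE.heatFlow (W s) (t - s) x -
      Literature.Analysis.FluidPDE.oseenDuhamel 1 s W W t x) ∧
    (∀ t : ℝ, t < 0 → ∀ x, Real.sqrt (-t) * ‖W t x‖ ≤ K) ∧ t₀ < 0 ∧ 0 < m ∧ (∀ y, ‖W t₀ y‖ ≤ m) ∧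
    0 < MeasureTheory.volume {y : EuclideanSpace ℝ (Fin 3) | ‖W t₀ y‖ = m}

/-- (S-B — PROVABLE; plan P1–P5 in §1b) SPARSE NEAR-PLATEAU STABILITY: item 28317 `RegularisedNearPlateauStability`
restricted to the SPARSE class `W·λ ≤ N₀·M²`, with constants `c₀(A,N₀), r(A,N₀)` uniform in `δ`.  For every derivative
budget `A` and sparseness level `N₀` there are `c₀, r > 0` such that for every `δ > 0` some `ε > 0` works: an admissible,
`A`-regular, `N₀`-sparse, non-degenerate, `(κ⋆−ε)`-efficient field has a ball of radius `r·λ` in which the near-top set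
`{‖v‖ ≥ (1−δ)M}` has volume `≥ c₀ (rλ)³`.  Mechanism: the global bang-bang inequality (★) of the file docstring with the
radial-gauge test potential. -/
def SparseNearPlateauStability : Prop :=
  ∀ A : ℕ → ℝ, (∀ j, 1 ≤ A j) → ∀ N₀ : ℝ, 0 < N₀ → ∃ c₀ r : ℝ, 0 < c₀ ∧ 0 < r ∧ ∀ δ : ℝ, 0 < δ → ∃ ε : ℝ, 0 < ε ∧
    ∀ (v : E3 → E3) (M B : ℝ), IsAdm v M B → IsReg A v M → IsSparse N₀ v M →
      0 < M * Real.sqrt (Zen v) * Real.sqrt (Wpa v) →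
      (kStar - ε) * M * Real.sqrt (Zen v) * Real.sqrt (Wpa v) ≤ |Jst v| →
        ∃ x₀ : E3, ENNReal.ofReal (c₀ * (r * lam v) ^ 3) ≤
          volume {x : E3 | x ∈ Metric.ball x₀ (r * lam v) ∧ (1 - δ) * M ≤ ‖v x‖}

/-- (S-E — OPEN HEART, the crowd wall on the flow side) SPARSE EFFICIENT TIMES: a violator flow of the crux has, for some
`N₀, Θ`, for every deficit `ε > 0` and onset `t₁ < T`, a late time `t ∈ [t₁,T)` that is (i) SPARSE: Leray-normalised
enstrophy `Z(t)·√(T−t) ≤ N₀·ν^{3/2}`; (ii) TWO-SIDED LOCKED: `Θ⁻¹·ν(T−t)·P ≤ Z ≤ Θ·ν(T−t)·P`; (iii) NEAR-EFFICIENT at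
level `ε` at some height bound `M ≥ ‖u(t)‖_∞` with `0 < M√Z√P`.  (ii)∧(iii) hold on a NON-NULL set of late times for every
`ε, t₁` (LANDED `PerFlow.scaleLock_at_nearEfficient_times`); the content is (i) at some of them.  Known for
(discretely) self-similar or finitely-many-cell concentration; ¬(S-E) = «crowd blow-up» (cell number → ∞ along all
near-efficient locked late times), the branch attacked by LINE g7-δ / item 27695. -/
def SparseEfficientTimes : Prop :=
  ∀ (C ν T : ℝ) (u : ℝ → E3 → E3) (p : ℝ → E3 → ℝ), IsViolator C ν T u p →
    ∃ N₀ Θ : ℝ, ∀ ε : ℝ, 0 < ε → ∀ t₁ ∈ Set.Ico 0 T, ∃ t ∈ Set.Ico t₁ T,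
      Zen (u t) * Real.sqrt (T - t) ≤ N₀ * (ν * Real.sqrt ν) ∧
      Θ⁻¹ * (ν * (T - t)) * Wpa (u t) ≤ Zen (u t) ∧ Zen (u t) ≤ Θ * (ν * (T - t)) * Wpa (u t) ∧
      ∃ M : ℝ, (∀ x, ‖u t x‖ ≤ M) ∧ 0 < M * Real.sqrt (Zen (u t)) * Real.sqrt (Wpa (u t)) ∧
        (kStar - ε) * M * Real.sqrt (Zen (u t)) * Real.sqrt (Wpa (u t)) ≤ |Jst (u t)|

/-- (S-T — provable-grade DYNAMIC TRANSFER, = item 28318's plan T1–T4 run at the sparse times) SPARSE SLICE TRANSFER: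
`SparseNearPlateauStability` and `SparseEfficientTimes` give, for every violator flow, the weak one-slice plateau object
of item 27822.  PLAN: (T1) higher Type-I rates `‖Dʲu(t)‖_∞ ≤ C_j ν^{(1−j)/2}(T−t)^{−(j+1)/2}` eventually (j = 1 landed
`PerFlow.gradTypeIRate_of_typeIRate`; all j on mild windows `KNSSBootstrap.exists_norm_iteratedFDeriv_slice_le`);
(T2) at a time of S-E with `M := ‖u(t)‖_∞`-pinned height: `IsAdm`, `IsReg A` with `A_j = C_j·Θ^{j/2}/c₀` (upper lock +
Leray's lower rate `lerayLowerRate_of_not_extends`), `IsSparse (N₀·√Θ/c₀²)` (lower lock + Leray), non-degenerate,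
`(κ⋆−ε)`-efficient; (T3) apply S-B with `δ_n ↓ 0`, `ε_n = ε(δ_n)`, `t_n ↑ T`; (T4) moving-centre zoom at the fat balls
(`volume_zoom_nearPlateau_ge`, `zoom_typeI_bound`, `zoomCompactnessKNSS`, `plateauPersistenceSlice`). -/
def SparseSliceTransfer : Prop :=
  SparseNearPlateauStability → SparseEfficientTimes →
    ∀ (C ν T : ℝ) (u : ℝ → E3 → E3) (p : ℝ → E3 → ℝ), IsViolator C ν T u p → WeakPlateauObject

end Summit.NavierStokesRegularity.NavierStokesRegularity.Theorems.NearExtremalTransiencePerFlow.SparseBangBang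

end
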